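import Summits.MatrixMultiplication.MatrixMultiplication.Theses.DesignFlattening

/-!
# MatrixMultiplication / DesignFlattening — `SeparableCubeFloor` (stmt-MatrixMultiplication-11433)

Route `DesignFlattening`, support item `SeparableCubeFloor`: every separable `k`-term toric design
`xyz^{⊗3} = Σ_{j<k} t_{j0} ⊗ t_{j1} ⊗ t_{j2}` of the third Kronecker power of the `xyz` tensor
`F` over the `ℤ₃` table (each `t_{ji} = [a+b+c=0]·u(a)v(b)w(c)` a toric point) has `k ≥ 5`.

Proof (elementary linear algebra, no flattening ranks): `F` is not a scalar multiple of a toric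
point (`F(0,1,2) = F(1,0,2) = F(1,2,0) = 1` force `u 0, v 0, w 0 ≠ 0`, but `F(0,0,0) = 0`); hence
`d·F ⊗ F` (`d ≠ 0`) is not a sum of `≤ 2` products of toric points (contract one factor with a
linear functional). Cube, `k ≤ 4`: contracting copy `0` with a functional `φ`, `φ(F) ≠ 0`, leaves a
design of `φ(F)·F ⊗ F`, so `φ` kills at most `|A| - 3` copy-`0` factors (`A` = indices with non-zero
copy-`1` and copy-`2` factors, `3 ≤ |A| ≤ 4`). `|A| = 3`: no functional vanishing on `t_{j0}`
separates `F`, so `F ∈ ℂ·t_{j0}`. `|A| = 4`: every pair spans a plane through `F`, so all `t_{j0}`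
lie on one plane `⟨t, F⟩` with pairwise distinct directions; but toric points have equal
transversal monomials `x₀₀₀x₁₁₁x₂₂₂ = x₀₁₂x₁₂₀x₂₀₁`, which on `σt + ρF` reads
`ρ(ρ² + e₁σρ + e₂σ²) = 0`: at most three directions (`ρ = 0`, or `σ/ρ` one of the two roots of
`e₂μ² + e₁μ + 1`), not four.
-/

-- the tree's namespace `Summit.MatrixMultiplication.MatrixMultiplication.…` repeats a component by design
set_option linter.dupNamespace false

open Literature.Computability.AlgebraicComplexity

namespace Summit.MatrixMultiplication.MatrixMultiplication.Theorems

/-- The `xyz` tensor is not a scalar multiple of a toric point `[a+b+c=0]·u(a)v(b)w(c)` of the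
`ℤ₃` table: the entries `(0,1,2), (1,0,2), (1,2,0)` force `c·u 0·v 0·w 0 ≠ 0`, but the diagonal
entry `(0,0,0)` of `xyz` vanishes. [folklore] -/
theorem sepCube_xyz_ne_smul_toric (c : ℂ) (u v w : Fin 3 → ℂ)
    (h : ∀ a b c' : Fin 3, xyzTensor ℂ a b c' =
      c * ((if a + b + c' = 0 then (1 : ℂ) else 0) * u a * v b * w c')) : False := by
  have h012 := h 0 1 2
  have h102 := h 1 0 2
  have h120 := h 1 2 0
  have h000 := h 0 0 0
  rw [xyzTensor_apply, if_pos (by decide), if_pos (by decide)] at h012 h102 h120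
  rw [xyzTensor_apply, if_neg (by decide), if_pos (by decide)] at h000
  have key : (c * (1 * u 0 * v 1 * w 2)) * (c * (1 * u 1 * v 0 * w 2)) *
      (c * (1 * u 1 * v 2 * w 0)) =
      (c * (1 * u 0 * v 0 * w 0)) * (c * c * u 1 * u 1 * v 1 * v 2 * w 2 * w 2) := by ring
  rw [← h012, ← h102, ← h120, ← h000] at key
  norm_num at key

/-- Separation by linear functionals in the space of `3 × 3 × 3` arrays: a vector outside the
span of a set is detected by a functional vanishing on the set (Mathlib's
`Subspace.forall_mem_dualAnnihilator_apply_eq_zero_iff`, repackaged). [folklore] -/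
theorem sepCube_exists_dual {x : Fin 3 → Fin 3 → Fin 3 → ℂ} {S : Set (Fin 3 → Fin 3 → Fin 3 → ℂ)}
    (hx : x ∉ Submodule.span ℂ S) :
    ∃ φ : Module.Dual ℂ (Fin 3 → Fin 3 → Fin 3 → ℂ), φ x ≠ 0 ∧ ∀ y ∈ S, φ y = 0 := by
  by_contra hne
  apply hx
  rw [← Subspace.forall_mem_dualAnnihilator_apply_eq_zero_iff]
  intro φ hφ
  by_contra hxne
  exact hne ⟨φ, hxne, fun y hy =>
    (Submodule.mem_dualAnnihilator φ).1 hφ y (Submodule.subset_span hy)⟩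

/-- **Square floor.** A non-zero multiple `d · xyz ⊗ xyz` of the Kronecker square of the `xyz`
tensor is not a sum of at most two Kronecker products `s_j ⊗ s'_j` of toric points of the `ℤ₃`
table: any index set `B` carrying such a design has `3 ≤ |B|` (so `N_sep(2) ≥ 3`; with the
refuter's three-term design, `N_sep(2) = 3`). [folklore] -/
theorem sepCube_square_floor {ι : Type*} [DecidableEq ι] (B : Finset ι)
    (s s' : ι → Fin 3 → Fin 3 → Fin 3 → ℂ) (u v w u' v' w' : ι → Fin 3 → ℂ)
    (hs : ∀ j a b c, s j a b c = (if a + b + c = 0 then (1 : ℂ) else 0) * u j a * v j b * w j c)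
    (hs' : ∀ j a b c, s' j a b c =
      (if a + b + c = 0 then (1 : ℂ) else 0) * u' j a * v' j b * w' j c)
    (d : ℂ) (hd : d ≠ 0)
    (h : ∀ a b c a' b' c' : Fin 3, d * (xyzTensor ℂ a b c * xyzTensor ℂ a' b' c') =
      ∑ j ∈ B, s j a b c * s' j a' b' c') :
    3 ≤ B.card := by
  have hF : xyzTensor ℂ 0 1 2 = 1 := by rw [xyzTensor_apply, if_pos (by decide)]
  by_contra hlt
  push Not at hlt
  -- evaluating the second factor at the entry `(0,1,2)` of `xyz`
  have hev : ∀ a b c, d * xyzTensor ℂ a b c = ∑ j ∈ B, s j a b c * s' j 0 1 2 := by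
    intro a b c
    have := h a b c 0 1 2
    rwa [hF, mul_one] at this
  obtain hB | hB | hB : B.card = 0 ∨ B.card = 1 ∨ B.card = 2 := by omega
  · rw [Finset.card_eq_zero] at hB
    subst hB
    have := hev 0 1 2
    rw [hF, Finset.sum_empty, mul_one] at this
    exact hd this
  · obtain ⟨j, rfl⟩ := Finset.card_eq_one.1 hB
    refine sepCube_xyz_ne_smul_toric (s' j 0 1 2 / d) (u j) (v j) (w j) fun a b c => ?_
    have := hev a b c
    rw [Finset.sum_singleton] at this
    rw [← hs]
    field_simp
    linear_combination this
  · obtain ⟨j₁, j₂, hne, rfl⟩ := Finset.card_eq_two.1 hB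
    simp only [Finset.sum_pair hne] at h hev
    by_cases hdep : s j₁ ∈ Submodule.span ℂ {s j₂}
    · obtain ⟨α, hα⟩ := Submodule.mem_span_singleton.1 hdep
      refine sepCube_xyz_ne_smul_toric ((α * s' j₁ 0 1 2 + s' j₂ 0 1 2) / d) (u j₂) (v j₂) (w j₂)
        fun a b c => ?_
      have := hev a b c
      rw [← hα, Pi.smul_apply, Pi.smul_apply, Pi.smul_apply, smul_eq_mul] at this
      rw [← hs]
      field_simp
      linear_combination this
    · obtain ⟨φ, hφ1, hφ2⟩ := sepCube_exists_dual hdep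
      have hφ2' : φ (s j₂) = 0 := hφ2 _ (Set.mem_singleton _)
      have vec : ∀ a' b' c',
          (d * xyzTensor ℂ a' b' c') • (xyzTensor ℂ : Fin 3 → Fin 3 → Fin 3 → ℂ) =
            s' j₁ a' b' c' • s j₁ + s' j₂ a' b' c' • s j₂ := by
        intro a' b' c'
        funext a b c
        simp only [Pi.smul_apply, Pi.add_apply, smul_eq_mul]
        linear_combination h a b c a' b' c'
      have sc : ∀ a' b' c', d * xyzTensor ℂ a' b' c' * φ (xyzTensor ℂ) =
          s' j₁ a' b' c' * φ (s j₁) := by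
        intro a' b' c'
        have := congrArg φ (vec a' b' c')
        rw [map_smul, map_add, map_smul, map_smul, hφ2', smul_zero, add_zero, smul_eq_mul,
          smul_eq_mul] at this
        exact this
      by_cases hφF : φ (xyzTensor ℂ) = 0
      · -- then `s' j₁ = 0` and the design has one term
        have hz : ∀ a b c, s' j₁ a b c = 0 := by
          intro a b c
          have := sc a b c
          rw [hφF, mul_zero] at this
          exact (mul_eq_zero.1 this.symm).resolve_right hφ1
        refine sepCube_xyz_ne_smul_toric (s' j₂ 0 1 2 / d) (u j₂) (v j₂) (w j₂) fun a b c => ?_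
        have := hev a b c
        rw [hz, mul_zero, zero_add] at this
        rw [← hs]
        field_simp
        linear_combination this
      · refine sepCube_xyz_ne_smul_toric (φ (s j₁) / (d * φ (xyzTensor ℂ))) (u' j₁) (v' j₁) (w' j₁)
          fun a b c => ?_
        have := sc a b c
        rw [← hs']
        field_simp
        linear_combination this

/-- Three distinct roots kill a quadratic with constant term `1`: if `p μ² + q μ + 1 = 0` at three
pairwise distinct `μ`, contradiction. [folklore] -/
theorem sepCube_quadratic (p q x y z : ℂ) (hx : p * x ^ 2 + q * x + 1 = 0)
    (hy : p * y ^ 2 + q * y + 1 = 0) (hz : p * z ^ 2 + q * z + 1 = 0)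
    (hxy : x ≠ y) (hxz : x ≠ z) (hyz : y ≠ z) : False := by
  have e1 : p * (x + y) + q = 0 := by
    have h : (x - y) * (p * (x + y) + q) = 0 := by linear_combination hx - hy
    exact (mul_eq_zero.1 h).resolve_left (sub_ne_zero.2 hxy)
  have e2 : p * (x + z) + q = 0 := by
    have h : (x - z) * (p * (x + z) + q) = 0 := by linear_combination hx - hz
    exact (mul_eq_zero.1 h).resolve_left (sub_ne_zero.2 hxz)
  have hp : p = 0 := by
    have h : (y - z) * p = 0 := by linear_combination e1 - e2
    exact (mul_eq_zero.1 h).resolve_left (sub_ne_zero.2 hyz)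
  have hq : q = 0 := by rw [hp, zero_mul, zero_add] at e1; exact e1
  rw [hp, hq] at hx
  norm_num at hx

open Summit.MatrixMultiplication.MatrixMultiplication.Theses.DesignFlattening in
/-- **`SeparableCubeFloor`** (route DesignFlattening, stmt-MatrixMultiplication-11433): every
separable `k`-term toric design of `xyz^{⊗3}` over the `ℤ₃` table `[a+b+c=0]` has `k ≥ 5`
(`N_sep(3) ≥ 5`; the determinant flattening only gives `⌈27/8⌉ = 4`). Substitution: a functional on
copy `0` non-zero at `xyz` leaves a design of `xyz^{⊗2}`, which needs three terms
(`sepCube_square_floor`); hence with `k ≤ 4` the copy-`0` factors are four pairwise non-parallel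
toric points on one plane through `xyz`, while the transversal-monomial cubic
`x₀₀₀x₁₁₁x₂₂₂ - x₀₁₂x₁₂₀x₂₀₁` allows at most three toric directions on such a plane. -/
theorem separableCubeFloor_proof :
    Summit.MatrixMultiplication.MatrixMultiplication.Theses.DesignFlattening.SeparableCubeFloor := by
  unfold SeparableCubeFloor
  intro k u v w hdes
  classical
  by_contra hk
  push Not at hk
  -- the toric factors `t j i`
  obtain ⟨t, ht⟩ : ∃ t : Fin k → Fin 3 → (Fin 3 → Fin 3 → Fin 3 → ℂ), ∀ j i a b c,
      t j i a b c = (if a + b + c = 0 then (1 : ℂ) else 0) * u j i a * v j i b * w j i c :=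
    ⟨fun j i a b c => (if a + b + c = 0 then (1 : ℂ) else 0) * u j i a * v j i b * w j i c,
      fun _ _ _ _ _ => rfl⟩
  -- the design identity on all `3⁹` entries
  have H9 : ∀ a0 b0 c0 a1 b1 c1 a2 b2 c2 : Fin 3,
      xyzTensor ℂ a0 b0 c0 * xyzTensor ℂ a1 b1 c1 * xyzTensor ℂ a2 b2 c2 =
        ∑ j, t j 0 a0 b0 c0 * t j 1 a1 b1 c1 * t j 2 a2 b2 c2 := by
    intro a0 b0 c0 a1 b1 c1 a2 b2 c2
    have h := hdes ![a0, a1, a2] ![b0, b1, b2] ![c0, c1, c2]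
    simp only [kroneckerPow_apply, Fin.prod_univ_three] at h
    simp only [Matrix.cons_val_zero, Matrix.cons_val_one, Matrix.cons_val_two, Matrix.head_cons,
      Matrix.tail_cons] at h
    simp only [ht]
    exact h
  -- the same identity, copy `0` as a vector
  have vec3 : ∀ a1 b1 c1 a2 b2 c2 : Fin 3,
      (xyzTensor ℂ a1 b1 c1 * xyzTensor ℂ a2 b2 c2) • (xyzTensor ℂ : (Fin 3 → Fin 3 → Fin 3 → ℂ)) =
        ∑ j, (t j 1 a1 b1 c1 * t j 2 a2 b2 c2) • t j 0 := by
    intro a1 b1 c1 a2 b2 c2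
    funext a b c
    simp only [Pi.smul_apply, Finset.sum_apply, smul_eq_mul]
    calc xyzTensor ℂ a1 b1 c1 * xyzTensor ℂ a2 b2 c2 * xyzTensor ℂ a b c
        = xyzTensor ℂ a b c * xyzTensor ℂ a1 b1 c1 * xyzTensor ℂ a2 b2 c2 := by ring
      _ = ∑ j, t j 0 a b c * t j 1 a1 b1 c1 * t j 2 a2 b2 c2 := H9 a b c a1 b1 c1 a2 b2 c2
      _ = ∑ j, t j 1 a1 b1 c1 * t j 2 a2 b2 c2 * t j 0 a b c :=
          Finset.sum_congr rfl fun j _ => by ring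
  -- contraction of copy `0` against a functional
  have contr : ∀ (φ : Module.Dual ℂ (Fin 3 → Fin 3 → Fin 3 → ℂ)) (a1 b1 c1 a2 b2 c2 : Fin 3),
      φ (xyzTensor ℂ) * (xyzTensor ℂ a1 b1 c1 * xyzTensor ℂ a2 b2 c2) =
        ∑ j, φ (t j 0) * t j 1 a1 b1 c1 * t j 2 a2 b2 c2 := by
    intro φ a1 b1 c1 a2 b2 c2
    have h := congrArg φ (vec3 a1 b1 c1 a2 b2 c2)
    rw [map_smul, map_sum] at h
    simp only [map_smul, smul_eq_mul] at h
    calc φ (xyzTensor ℂ) * (xyzTensor ℂ a1 b1 c1 * xyzTensor ℂ a2 b2 c2)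
        = xyzTensor ℂ a1 b1 c1 * xyzTensor ℂ a2 b2 c2 * φ (xyzTensor ℂ) := by ring
      _ = ∑ j, t j 1 a1 b1 c1 * t j 2 a2 b2 c2 * φ (t j 0) := h
      _ = ∑ j, φ (t j 0) * t j 1 a1 b1 c1 * t j 2 a2 b2 c2 :=
          Finset.sum_congr rfl fun j _ => by ring
  -- `A` = indices whose copy-1 and copy-2 factors are non-zero
  set A : Finset (Fin k) := Finset.univ.filter fun j => t j 1 ≠ 0 ∧ t j 2 ≠ 0 with hAdef
  -- KEY (square floor after contraction): a functional non-zero at `xyz` kills few copy-0 factors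
  have key : ∀ φ : Module.Dual ℂ (Fin 3 → Fin 3 → Fin 3 → ℂ), φ (xyzTensor ℂ) ≠ 0 →
      3 ≤ (A.filter fun j => φ (t j 0) ≠ 0).card := by
    intro φ hφ
    refine sepCube_square_floor (A.filter fun j => φ (t j 0) ≠ 0) (fun j => φ (t j 0) • t j 1)
      (fun j => t j 2) (fun j a => φ (t j 0) * u j 1 a) (fun j => v j 1) (fun j => w j 1)
      (fun j => u j 2) (fun j => v j 2) (fun j => w j 2)
      (fun j a b c => by simp only [Pi.smul_apply, smul_eq_mul, ht]; ring)
      (fun j a b c => ht j 2 a b c) (φ (xyzTensor ℂ)) hφ ?_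
    intro a b c a' b' c'
    simp only [Pi.smul_apply, smul_eq_mul]
    rw [contr]
    refine (Finset.sum_subset (Finset.subset_univ _) fun j _ hj => ?_).symm
    by_cases h0 : φ (t j 0) = 0
    · simp [h0]
    by_cases h1 : t j 1 = 0
    · simp [h1]
    by_cases h2 : t j 2 = 0
    · simp [h2]
    have hjA : j ∈ A := by
      rw [hAdef, Finset.mem_filter]
      exact ⟨Finset.mem_univ _, h1, h2⟩
    exact absurd (Finset.mem_filter.2 ⟨hjA, h0⟩) hj
  -- C: `xyz` is on no line `ℂ · t j 0`
  have hC : ∀ j, (xyzTensor ℂ : (Fin 3 → Fin 3 → Fin 3 → ℂ)) ∉ Submodule.span ℂ {t j 0} := by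
    intro j hmem
    obtain ⟨a, ha⟩ := Submodule.mem_span_singleton.1 hmem
    exact sepCube_xyz_ne_smul_toric a (u j 0) (v j 0) (w j 0) fun x y z => by
      rw [← ha, Pi.smul_apply, Pi.smul_apply, Pi.smul_apply, smul_eq_mul, ht]
  -- D: `3 ≤ |A| ≤ k ≤ 4`, by evaluating at the entry `(0,1,2)`
  have hF012 : xyzTensor ℂ 0 1 2 = 1 := by rw [xyzTensor_apply, if_pos (by decide)]
  let ev : Module.Dual ℂ (Fin 3 → Fin 3 → Fin 3 → ℂ) :=
    { toFun := fun x => x 0 1 2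
      map_add' := fun _ _ => rfl
      map_smul' := fun _ _ => rfl }
  have hA3 : 3 ≤ A.card :=
    (key ev (by show xyzTensor ℂ 0 1 2 ≠ 0; rw [hF012]; exact one_ne_zero)).trans
      (Finset.card_filter_le _ _)
  have hAk : A.card ≤ k := (Finset.card_le_univ A).trans_eq (Fintype.card_fin k)
  -- B: any two indices of `A` span a plane through `xyz`
  have hB : ∀ j ∈ A, ∀ j' ∈ A, j ≠ j' →
      (xyzTensor ℂ : (Fin 3 → Fin 3 → Fin 3 → ℂ)) ∈ Submodule.span ℂ {t j 0, t j' 0} := by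
    intro j hj j' hj' hne
    by_contra hnot
    obtain ⟨φ, hφF, hφ0⟩ := sepCube_exists_dual hnot
    have h3 := key φ hφF
    have hsub : (A.filter fun i => φ (t i 0) ≠ 0) ⊆ (A.erase j).erase j' := by
      intro i hi
      rw [Finset.mem_filter] at hi
      rw [Finset.mem_erase, Finset.mem_erase]
      refine ⟨?_, ?_, hi.1⟩
      · rintro rfl
        exact hi.2 (hφ0 _ (by simp))
      · rintro rfl
        exact hi.2 (hφ0 _ (by simp))
    have hle := Finset.card_le_card hsub
    rw [Finset.card_erase_of_mem (Finset.mem_erase.2 ⟨hne.symm, hj'⟩),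
      Finset.card_erase_of_mem hj] at hle
    omega
  obtain hA3eq | hA4eq : A.card = 3 ∨ A.card = 4 := by omega
  · -- `|A| = 3`: no functional vanishing on `t j 0` separates `xyz`
    obtain ⟨j, hj⟩ : A.Nonempty := Finset.card_pos.1 (by omega)
    obtain ⟨φ, hφF, hφ0⟩ := sepCube_exists_dual (hC j)
    have h3 := key φ hφF
    have hsub : (A.filter fun i => φ (t i 0) ≠ 0) ⊆ A.erase j := by
      intro i hi
      rw [Finset.mem_filter] at hi
      exact Finset.mem_erase.2 ⟨by rintro rfl; exact hi.2 (hφ0 _ (by simp)), hi.1⟩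
    have hle := Finset.card_le_card hsub
    rw [Finset.card_erase_of_mem hj] at hle
    omega
  · -- `|A| = 4`: four pairwise non-parallel toric points on the plane `⟨t j₀ 0, xyz⟩`
    obtain ⟨j₀, hj₀⟩ : A.Nonempty := Finset.card_pos.1 (by omega)
    have hrepr : ∀ j, ∃ σ ρ : ℂ, j ∈ A → ∀ x y z,
        t j 0 x y z = σ * t j₀ 0 x y z + ρ * xyzTensor ℂ x y z := by
      intro j
      by_cases hjA : j ∈ A
      · by_cases hj0 : j = j₀
        · subst hj0
          exact ⟨1, 0, fun _ x y z => by ring⟩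
        · obtain ⟨a, b, hab⟩ := Submodule.mem_span_pair.1 (hB j₀ hj₀ j hjA (Ne.symm hj0))
          have hb : b ≠ 0 := by
            rintro rfl
            apply hC j₀
            rw [Submodule.mem_span_singleton]
            exact ⟨a, by simpa using hab⟩
          refine ⟨-(a / b), 1 / b, fun _ x y z => ?_⟩
          have := congrFun (congrFun (congrFun hab x) y) z
          simp only [Pi.add_apply, Pi.smul_apply, smul_eq_mul] at this
          field_simp
          linear_combination this
      · exact ⟨0, 0, fun h => absurd h hjA⟩
    choose σ ρ hσρ using hrepr
    -- at most one direction with `ρ = 0` (that of `t j₀ 0` itself)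
    have hρ0 : (A.filter fun j => ρ j = 0).card ≤ 1 := by
      rw [Finset.card_le_one]
      intro j hj j' hj'
      rw [Finset.mem_filter] at hj hj'
      by_contra hne
      apply hC j₀
      have hle : Submodule.span ℂ {t j 0, t j' 0} ≤ Submodule.span ℂ {t j₀ 0} := by
        rw [Submodule.span_le]
        intro x hx
        simp only [Set.mem_insert_iff, Set.mem_singleton_iff] at hx
        rw [SetLike.mem_coe, Submodule.mem_span_singleton]
        rcases hx with rfl | rfl
        · refine ⟨σ j, ?_⟩
          funext x y z
          rw [Pi.smul_apply, Pi.smul_apply, Pi.smul_apply, smul_eq_mul, hσρ j hj.1, hj.2]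
          ring
        · refine ⟨σ j', ?_⟩
          funext x y z
          rw [Pi.smul_apply, Pi.smul_apply, Pi.smul_apply, smul_eq_mul, hσρ j' hj'.1, hj'.2]
          ring
      exact hle (hB j hj.1 j' hj'.1 hne)
    have hA' : 2 < (A.filter fun j => ¬ ρ j = 0).card := by
      have := Finset.card_filter_add_card_filter_not (s := A) (fun j => ρ j = 0)
      omega
    obtain ⟨j₁, hj₁, j₂, hj₂, j₃, hj₃, h12, h13, h23⟩ := Finset.two_lt_card.1 hA'
    rw [Finset.mem_filter] at hj₁ hj₂ hj₃
    -- the transversal monomials agree on toric points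
    have c000 : (0 : Fin 3) + 0 + 0 = 0 := by decide
    have c111 : (1 : Fin 3) + 1 + 1 = 0 := by decide
    have c222 : (2 : Fin 3) + 2 + 2 = 0 := by decide
    have c012 : (0 : Fin 3) + 1 + 2 = 0 := by decide
    have c120 : (1 : Fin 3) + 2 + 0 = 0 := by decide
    have c201 : (2 : Fin 3) + 0 + 1 = 0 := by decide
    have htor : ∀ j, t j 0 0 0 0 * t j 0 1 1 1 * t j 0 2 2 2 =
        t j 0 0 1 2 * t j 0 1 2 0 * t j 0 2 0 1 := by
      intro j
      simp only [ht, if_pos c000, if_pos c111, if_pos c222, if_pos c012, if_pos c120, if_pos c201]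
      ring
    have hF000 : xyzTensor ℂ 0 0 0 = 0 := by rw [xyzTensor_apply, if_neg (by decide)]
    have hF111 : xyzTensor ℂ 1 1 1 = 0 := by rw [xyzTensor_apply, if_neg (by decide)]
    have hF222 : xyzTensor ℂ 2 2 2 = 0 := by rw [xyzTensor_apply, if_neg (by decide)]
    have hF120 : xyzTensor ℂ 1 2 0 = 1 := by rw [xyzTensor_apply, if_pos (by decide)]
    have hF201 : xyzTensor ℂ 2 0 1 = 1 := by rw [xyzTensor_apply, if_pos (by decide)]
    -- on the plane, toric points with `ρ ≠ 0` have `μ = σ/ρ` a root of `e₂ μ² + e₁ μ + 1`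
    have hquad : ∀ j ∈ A, ¬ ρ j = 0 →
        (t j₀ 0 0 1 2 * t j₀ 0 1 2 0 + t j₀ 0 1 2 0 * t j₀ 0 2 0 1 + t j₀ 0 2 0 1 * t j₀ 0 0 1 2) *
            (σ j / ρ j) ^ 2 +
          (t j₀ 0 0 1 2 + t j₀ 0 1 2 0 + t j₀ 0 2 0 1) * (σ j / ρ j) + 1 = 0 := by
      intro j hj hρ
      have rel := htor j
      simp only [hσρ j hj, hF000, hF111, hF222, hF012, hF120, hF201, mul_zero, add_zero,
        mul_one] at rel
      have hT0 := htor j₀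
      have h3 : ρ j * ((t j₀ 0 0 1 2 * t j₀ 0 1 2 0 + t j₀ 0 1 2 0 * t j₀ 0 2 0 1 +
            t j₀ 0 2 0 1 * t j₀ 0 0 1 2) * σ j ^ 2 +
          (t j₀ 0 0 1 2 + t j₀ 0 1 2 0 + t j₀ 0 2 0 1) * σ j * ρ j + ρ j ^ 2) = 0 := by
        linear_combination (-1 : ℂ) * rel + (σ j) ^ 3 * hT0
      have h4 := (mul_eq_zero.1 h3).resolve_left hρ
      field_simp
      linear_combination h4
    -- distinct indices give distinct roots
    have hdist : ∀ j ∈ A, ∀ j' ∈ A, ¬ ρ j = 0 → ¬ ρ j' = 0 → j ≠ j' →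
        σ j / ρ j ≠ σ j' / ρ j' := by
      intro j hj j' hj' hρ hρ' hne heq
      rw [div_eq_div_iff hρ hρ'] at heq
      apply hC j'
      have hle : Submodule.span ℂ {t j 0, t j' 0} ≤ Submodule.span ℂ {t j' 0} := by
        rw [Submodule.span_le]
        intro x hx
        simp only [Set.mem_insert_iff, Set.mem_singleton_iff] at hx
        rw [SetLike.mem_coe, Submodule.mem_span_singleton]
        rcases hx with rfl | rfl
        · refine ⟨ρ j / ρ j', ?_⟩
          funext x y z
          rw [Pi.smul_apply, Pi.smul_apply, Pi.smul_apply, smul_eq_mul, hσρ j hj, hσρ j' hj']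
          field_simp
          linear_combination t j₀ 0 x y z * heq.symm
        · exact ⟨1, one_smul _ _⟩
      exact hle (hB j hj j' hj' hne)
    exact sepCube_quadratic _ _ (σ j₁ / ρ j₁) (σ j₂ / ρ j₂) (σ j₃ / ρ j₃)
      (hquad j₁ hj₁.1 hj₁.2) (hquad j₂ hj₂.1 hj₂.2) (hquad j₃ hj₃.1 hj₃.2)
      (hdist _ hj₁.1 _ hj₂.1 hj₁.2 hj₂.2 h12) (hdist _ hj₁.1 _ hj₃.1 hj₁.2 hj₃.2 h13)
      (hdist _ hj₂.1 _ hj₃.1 hj₂.2 hj₃.2 h23)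

end Summit.MatrixMultiplication.MatrixMultiplication.Theorems
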